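import Mathlib.Analysis.InnerProductSpace.Basic
import Mathlib.Analysis.Matrix.Order
import Mathlib.LinearAlgebra.Matrix.Hadamard
import HarnessLib
import Literature.Analysis.OperatorTheory.FiniteRankGramBound

/-!
# Hilbert–Schmidt bound for a finite-rank kernel: `|Σ_j ⟪f, p_j⟫ ⟪g, r_j⟫| ≤ ‖f‖ ‖g‖ √tr(G_p G_r)`

Analysis/OperatorTheory file (everything proved, no named facts). Let `E`, `F` be real inner product
spaces, `p : ι → E`, `r : ι → F` finite families with Gram matrices `G_p = (⟪p_i, p_j⟫)`,
`G_r = (⟪r_i, r_j⟫)`. The bilinear form `B(f, g) := Σ_j ⟪f, p_j⟫ ⟪g, r_j⟫` (the rank-`|ι|` kernel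
`K = Σ_j p_j ⊗ r_j`) satisfies

  `|B(f, g)| ≤ ‖f‖ ‖g‖ · √(Σ_{i,j} ⟪p_i, p_j⟫ ⟪r_i, r_j⟫) = ‖f‖ ‖g‖ · √tr(G_p G_r) = ‖f‖ ‖g‖ ‖K‖_{HS}`.

Proof: `B(f, g) = ⟪f, v⟫` with `v := Σ_j ⟪g, r_j⟫ p_j`, so `B² ≤ ‖f‖² ‖v‖²` and
`‖v‖² = Σ_{ij} β_i β_j ⟪p_i, p_j⟫` (`β_j := ⟪g, r_j⟫`). With `r'_i := ‖g‖² r_i − β_i g` one has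
`⟪r'_i, r'_j⟫ = ‖g‖² (‖g‖² ⟪r_i, r_j⟫ − β_i β_j)`, and `Σ_{ij} ⟪p_i, p_j⟫ ⟪r'_i, r'_j⟫ ≥ 0` because it
is the all-ones quadratic form of the Hadamard product of two Gram matrices (Schur product theorem,
`Matrix.PosSemidef.hadamard`); hence `Σ_{ij} β_i β_j ⟪p_i, p_j⟫ ≤ ‖g‖² Σ_{ij} ⟪p_i, p_j⟫ ⟪r_i, r_j⟫`.

## Why it is here (source and use)

Elementary ([folklore]: the operator norm of a finite-rank operator is at most its Hilbert–Schmidt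
norm; e.g. Reed–Simon I, Thm VI.22 / Horn–Johnson 2013 §7.5 for Schur). It is the step
`|I₃| ≤ K₇ ‖f‖_Ω ‖f‖_{ℝ³}`, `K₇ = √tr(G_{Q²} G_r)`, of Lemma E.3 in the cell note
`pub-nsjs/pub-nsjs-typer/LEMMA-E.md` (Jia–Šverák programme, certified-enclosure lane; the finite-rank
scheme is Hou–Wang–Yang's, arXiv:2509.25116 v2, (est i3) TeX L3996–4001, under adjudication in that
cell and NOT cited for this step — re-derived here and kernel-checked): there `p_j = λ̄_j⁻¹ Q ψ̄_j ∈
L²(Ω)`, `r_j ∈ L²(ℝ³)` (the two spaces are DIFFERENT, which is exactly the point of remark R2 /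
G-S3: `G_r` is the Gram matrix on `ℝ³`), `f = f|_Ω`, `g = f`. Nothing about Navier–Stokes is typed here.
-/

open Finset Matrix

namespace Literature.Analysis.OperatorTheory

variable {E : Type*} [NormedAddCommGroup E] [InnerProductSpace ℝ E]
variable {F : Type*} [NormedAddCommGroup F] [InnerProductSpace ℝ F]
variable {ι : Type*} [Fintype ι]

/-- The Gram matrix `(⟪p_i, p_j⟫)_{ij}` of a finite family. [folklore] -/
noncomputable def gramMatrix (p : ι → E) : Matrix ι ι ℝ := Matrix.of fun i j => inner ℝ (p i) (p j)

/-- A Gram matrix is positive semidefinite: `xᵀ G x = ‖Σ x_i p_i‖² ≥ 0`. [folklore] -/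
theorem gramMatrix_posSemidef (p : ι → E) : (gramMatrix p).PosSemidef := by
  rw [Matrix.posSemidef_iff_dotProduct_mulVec]
  refine ⟨?_, fun x => ?_⟩
  · ext i j
    simp [gramMatrix, Matrix.conjTranspose_apply, real_inner_comm]
  · have h : star x ⬝ᵥ (gramMatrix p *ᵥ x) = ∑ i, ∑ j, x i * x j * inner ℝ (p i) (p j) := by
      simp only [dotProduct, Matrix.mulVec, star_trivial, gramMatrix, Matrix.of_apply,
        Finset.mul_sum]
      exact Finset.sum_congr rfl fun i _ => Finset.sum_congr rfl fun j _ => by ring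
    rw [h, ← norm_sq_sum_smul_eq_gramForm]
    positivity

/-- **Trace of a product of two Gram matrices is non-negative**:
`Σ_{i,j} ⟪p_i, p_j⟫ ⟪q_i, q_j⟫ = 𝟙ᵀ (G_p ⊙ G_q) 𝟙 ≥ 0` (Schur product theorem). [folklore] -/
theorem sum_gram_mul_gram_nonneg (p : ι → E) (q : ι → F) :
    0 ≤ ∑ i, ∑ j, inner ℝ (p i) (p j) * inner ℝ (q i) (q j) := by
  have h := ((gramMatrix_posSemidef p).hadamard (gramMatrix_posSemidef q)).dotProduct_mulVec_nonneg
    (fun _ : ι => (1 : ℝ))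
  simpa [dotProduct, Matrix.mulVec, Matrix.hadamard_apply, gramMatrix] using h

/-- The coefficient form `Σ_{ij} β_i β_j ⟪p_i, p_j⟫` with `β_j = ⟪g, r_j⟫` is dominated by
`‖g‖² · Σ_{ij} ⟪p_i, p_j⟫ ⟪r_i, r_j⟫`. [folklore] -/
theorem sum_inner_mul_inner_gram_le (p : ι → E) (r : ι → F) (g : F) :
    ∑ i, ∑ j, inner ℝ g (r i) * inner ℝ g (r j) * inner ℝ (p i) (p j)
      ≤ ‖g‖ ^ 2 * ∑ i, ∑ j, inner ℝ (p i) (p j) * inner ℝ (r i) (r j) := by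
  set β : ι → ℝ := fun j => inner ℝ g (r j) with hβdef
  have hβ : ∀ i, inner ℝ (r i) g = β i := fun i => real_inner_comm g (r i)
  set S := ∑ i, ∑ j, inner ℝ (p i) (p j) * inner ℝ (r i) (r j) with hS
  set T := ∑ i, ∑ j, β i * β j * inner ℝ (p i) (p j) with hT
  rcases (norm_nonneg g).lt_or_eq with hg | hg
  · -- the shifted family `r'_i := ‖g‖² r_i − β_i g`
    set r' : ι → F := fun i => (‖g‖ ^ 2) • r i - β i • g with hr'def
    have hr' : ∀ i j, inner ℝ (r' i) (r' j)
        = ‖g‖ ^ 2 * (‖g‖ ^ 2 * inner ℝ (r i) (r j) - β i * β j) := by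
      intro i j
      simp only [hr'def, inner_sub_left, inner_sub_right, real_inner_smul_left,
        real_inner_smul_right, real_inner_self_eq_norm_sq, hβ]
      ring
    have h0 := sum_gram_mul_gram_nonneg p r'
    have h1 : ∑ i, ∑ j, inner ℝ (p i) (p j) * inner ℝ (r' i) (r' j)
        = ‖g‖ ^ 2 * (‖g‖ ^ 2 * S - T) := by
      rw [hS, hT]
      simp only [Finset.mul_sum, ← Finset.sum_sub_distrib]
      refine Finset.sum_congr rfl fun i _ => Finset.sum_congr rfl fun j _ => ?_
      rw [hr']; ring
    rw [h1] at h0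
    have hg2 : 0 < ‖g‖ ^ 2 := by positivity
    have : 0 ≤ ‖g‖ ^ 2 * S - T := nonneg_of_mul_nonneg_right (by linarith [h0]) hg2
    linarith
  · -- `g = 0`: both sides vanish
    have hg0 : g = 0 := norm_eq_zero.mp hg.symm
    have hβ0 : ∀ i, β i = 0 := fun i => by simp [hβdef, hg0]
    have hS0 : 0 ≤ S := by rw [hS]; exact sum_gram_mul_gram_nonneg p r
    have hT0 : T = 0 := by simp [hT, hβ0]
    rw [hT0]; positivity

/-- **Hilbert–Schmidt bound for a finite-rank kernel** (squared form):
`(Σ_j ⟪f, p_j⟫ ⟪g, r_j⟫)² ≤ ‖f‖² ‖g‖² Σ_{i,j} ⟪p_i, p_j⟫ ⟪r_i, r_j⟫`. [folklore] -/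
theorem sq_sum_inner_mul_inner_le (p : ι → E) (r : ι → F) (f : E) (g : F) :
    (∑ j, inner ℝ f (p j) * inner ℝ g (r j)) ^ 2
      ≤ ‖f‖ ^ 2 * ‖g‖ ^ 2 * ∑ i, ∑ j, inner ℝ (p i) (p j) * inner ℝ (r i) (r j) := by
  set β : ι → ℝ := fun j => inner ℝ g (r j) with hβdef
  set v : E := ∑ j, β j • p j with hv
  have h1 : ∑ j, inner ℝ f (p j) * inner ℝ g (r j) = inner ℝ f v := by
    rw [hv, inner_sum]
    exact Finset.sum_congr rfl fun j _ => by rw [real_inner_smul_right]; ring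
  have h2 : (inner ℝ f v) ^ 2 ≤ ‖f‖ ^ 2 * ‖v‖ ^ 2 := by
    have := abs_real_inner_le_norm f v
    calc (inner ℝ f v) ^ 2 = |inner ℝ f v| ^ 2 := (sq_abs _).symm
      _ ≤ (‖f‖ * ‖v‖) ^ 2 := by gcongr
      _ = ‖f‖ ^ 2 * ‖v‖ ^ 2 := by ring
  have h3 : ‖v‖ ^ 2 ≤ ‖g‖ ^ 2 * ∑ i, ∑ j, inner ℝ (p i) (p j) * inner ℝ (r i) (r j) := by
    rw [hv, norm_sq_sum_smul_eq_gramForm]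
    exact sum_inner_mul_inner_gram_le p r g
  calc (∑ j, inner ℝ f (p j) * inner ℝ g (r j)) ^ 2 = (inner ℝ f v) ^ 2 := by rw [h1]
    _ ≤ ‖f‖ ^ 2 * ‖v‖ ^ 2 := h2
    _ ≤ ‖f‖ ^ 2 * (‖g‖ ^ 2 * ∑ i, ∑ j, inner ℝ (p i) (p j) * inner ℝ (r i) (r j)) := by gcongr
    _ = _ := by ring

/-- **Hilbert–Schmidt bound for a finite-rank kernel**:
`|Σ_j ⟪f, p_j⟫ ⟪g, r_j⟫| ≤ ‖f‖ ‖g‖ √(Σ_{i,j} ⟪p_i, p_j⟫ ⟪r_i, r_j⟫)` — the constant is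
`K₇ = √tr(G_p G_r)`. [folklore] -/
theorem abs_sum_inner_mul_inner_le (p : ι → E) (r : ι → F) (f : E) (g : F) :
    |∑ j, inner ℝ f (p j) * inner ℝ g (r j)|
      ≤ ‖f‖ * ‖g‖ * Real.sqrt (∑ i, ∑ j, inner ℝ (p i) (p j) * inner ℝ (r i) (r j)) := by
  have hS := sum_gram_mul_gram_nonneg p r
  have h := Real.abs_le_sqrt (sq_sum_inner_mul_inner_le p r f g)
  calc |∑ j, inner ℝ f (p j) * inner ℝ g (r j)|
      ≤ Real.sqrt (‖f‖ ^ 2 * ‖g‖ ^ 2 * ∑ i, ∑ j, inner ℝ (p i) (p j) * inner ℝ (r i) (r j)) := h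
    _ = ‖f‖ * ‖g‖ * Real.sqrt (∑ i, ∑ j, inner ℝ (p i) (p j) * inner ℝ (r i) (r j)) := by
      rw [Real.sqrt_mul (by positivity), Real.sqrt_mul (by positivity), Real.sqrt_sq (norm_nonneg _),
        Real.sqrt_sq (norm_nonneg _)]

end Literature.Analysis.OperatorTheory
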